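import Summits.SmoothPoincare4.SmoothPoincare4.Theorems.ConvexBisectionAcyclicBisectionExistsStubNiceSplitting
import Literature.Topology.FourManifolds.LefschetzHandlebody
import Literature.Topology.FourManifolds.SmoothOrientation
import Literature.GroupTheory.CombinatorialGroupTheory.SignedHurwitzAction
import Literature.AlgebraicTopology.SingularHomology.SingularChains
import Literature.AlgebraicTopology.SingularHomology.IntersectionFormProofs
import Literature.AlgebraicTopology.SingularHomology.BoundaryManifoldFiniteness
import HarnessLib

/-!
# Ingredients of the counts of a one-sided Lefschetz model of a homotopy 4-sphere
(stub `stub_modelsOn_counts` of line `modp-braid-orbits`, reshape r9, crux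
`ConvexBisection.AcyclicBisectionExists`, item stmt-SmoothPoincare4-10508)

The registered stub is verbatim the named Literature fact
`LefschetzBase.modelsOn_counts_of_homotopyEquiv_sphere` (Gompf–Stipsicz 1999, §8.2; Etnyre–Fuller 2006,
§2): if `M ≃ₕ S⁴` and `ModelsOn M g l` (`M = X ∪_Ψ Base g`, `X = X(F_{g,1}; l)` the Lefschetz handlebody
of the signed word `l` over the concrete base `Base g ⊂ ℂ²`) then `l.length = 4g`, the classes of `l` span
`ℚ^{2g}`, and the signed homological monodromy `wordProduct (stdSymp ℤ g) l` is `1`.  Its printed proof has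
three inputs that are NOT in the tree — the topology of the concrete base (`Base g ≃ F_{g,1} × D²`:
`H₂(Base g; ℚ) = 0`, `H₁(∂ Base g; ℤ) ≅ ℤ^{2g}`; Milnor 1968, Thm. 9.1, named `exists_isChainShadow`), the
homology of a Lefschetz handlebody (`H₁(X; ℤ) ≅ ℤ^{2g}/⟨classes⟩`, Gompf–Stipsicz §8.2) and the open book on
its boundary (`H₁(∂X; ℤ) ≅ coker(μ_* − 1)`, Kas 1980) — and a vocabulary-free remainder, which is what this
file PROVES:

* `isZero_homology_one_of_gluing_base` — for ANY boundary gluing `M = X ∪_Ψ Base g` of a homotopy 4-sphere,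
  `H₂(Base g; ℚ) = 0 ⇒ H₁(X; ℚ) = 0` (excision for the gluing, Lefschetz duality for the orientation of
  `Base g` pulled back from `M`, exactness of `H₂(M, X) → H₁(X) → H₁(M) = 0`; the seam `∂ Base g` is shown
  nonempty by an explicit point, `nonempty_bBase_carrier`), and `connectedSpace_of_gluing_base`
  (`H₃(Base g; ℚ) = 0 ⇒ X` connected);
* `span_letters_ratWord_eq_top_of_isTorsion` — if `ℤ^{2g}/⟨classes of l⟩` is a torsion group then the
  classes span `ℚ^{2g}`: the second clause of the stub, verbatim; `isTorsion_homology_int_of_isZero_rat`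
  (`H₁(X; ℚ) = 0 ⇒ H₁(X; ℤ)` torsion, from the tree's finiteness of the homology of compact manifolds with
  boundary and `b₁(X; ℤ) = b₁(X; ℚ)`) and `span_letters_ratWord_eq_top_of_gluing_base` assemble it: for a
  gluing as above with `H₂(Base g; ℚ) = 0` and `H₁(X; ℤ) ≅ ℤ^{2g}/⟨classes⟩`, the classes span `ℚ^{2g}`;
* `eq_zero_of_nonempty_quotient_range_equiv` / `wordProduct_eq_one_of_nonempty_coker_equiv` /
  `wordProduct_eq_one_of_seam` — an endomorphism `A` of `ℤⁿ` with `ℤⁿ/im A ≅ ℤⁿ` is `0` (rank–nullity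
  over the PID `ℤ`); applied to `A = wordProduct (stdSymp ℤ g) l − 1` and to the seam
  `Ψ : ∂X ≅ ∂ Base g` (`H₁(∂X; ℤ) ≅ coker(μ_* − 1)` and `H₁(∂ Base g; ℤ) ≅ ℤ^{2g}` as hypotheses) this is
  the third clause of the stub, verbatim.

Audit of the registered statement (no defect found): at `g = 0` the span and monodromy clauses are
automatic and the statement reads "a model `S⁴ ≃ₕ X ∪ Base 0` has no 2-handles" (`counts_genus_zero_iff`;
`Base 0 = {‖y² − x − 1‖² + eta ‖x‖² ≤ 1/4}` fibres over `‖w‖ ≤ 1/2` with disc pages `y² = x + 1 + w`,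
`‖x‖ ≤ 2`, so it is a 4-ball and `χ` gives `n = 0`); for `g ≥ 1` the fibre of `w` over `‖x‖ ≤ 2` is the
double cover of the disc branched at the `2g+1` roots of `x^{2g+1} = −(1 + w)` (all of modulus `< 3/2`),
i.e. `F_{g,1}`, and the collar `4 < ‖x‖² < 6` adds `∂F × D² × I`, so `Base g ≅ F_{g,1} × D²` as documented;
the third clause is sensitive to the product of the three signs of `LefschetzBasePages.lean`, Conventions
(a)–(c), each of which was re-derived (boundary orientation `(K', iK', n)` positive; clockwise `pageDir` with
first letter outermost = Akbulut–Ozbagci's `D(γ_m) ⋯ D(γ_1)`; the `A_{2g}` chain is a `+1`-chain,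
`Im(conj(−r_in) r_out) > 0`, matching `stdSymp (chainVec i) (chainVec (i+1)) = 1` and Picard–Lefschetz
`T_a b = b + (a·b) a` = `transvection`).

Nothing is asserted: no named facts, no `sorry`; every hypothesis about `Base g`, `X`, `∂X` is explicit.
-/

noncomputable section

-- the prescribed namespace `Summit.<P>.<Sub>.…` duplicates `SmoothPoincare4` (P = Sub)
set_option linter.dupNamespace false

open scoped Manifold ContDiff Topology ContinuousMap
open Set Function CategoryTheory CategoryTheory.Limits
open Literature.GroupTheory.CombinatorialGroupTheory.SignedHurwitz Literature.Topology.FourManifolds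
  Literature.Topology.FourManifolds.LefschetzBase Literature.AlgebraicTopology.SingularHomology

namespace Summit.SmoothPoincare4.SmoothPoincare4.Theorems.AcyclicBisectionExists.ModpBraidOrbits

open Summit.SmoothPoincare4.SmoothPoincare4.Theorems.AcyclicBisectionExists.Negative

/-! ## Linear algebra of the second and third clauses -/

section Algebra

/-- **An endomorphism of `ℤⁿ` whose cokernel is free of rank `n` vanishes**: from
`rank(ℤⁿ/im A) + rank(im A) = n` (rank–nullity over the domain `ℤ`) and `ℤⁿ/im A ≅ ℤⁿ` we get
`rank(im A) = 0`, and `im A ⊆ ℤⁿ` is torsion-free.  This is the algebra of "`H₁(∂X; ℤ) ≅ ℤ^{2g} =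
coker(μ_* − 1)` forces `μ_* = 1`" (Gompf–Stipsicz 1999, §8.2). [folklore] -/
theorem eq_zero_of_nonempty_quotient_range_equiv {ι : Type*} [Fintype ι] (A : Module.End ℤ (ι → ℤ))
    (h : Nonempty (((ι → ℤ) ⧸ LinearMap.range A) ≃ₗ[ℤ] (ι → ℤ))) : A = 0 := by
  obtain ⟨e⟩ := h
  -- both ranks restated in one elaboration context (the `ℤ`-module instances on `ι → ℤ` and on the
  -- quotient have several syntactic forms)
  have h1 : Module.finrank ℤ ((ι → ℤ) ⧸ LinearMap.range A) + Module.finrank ℤ (LinearMap.range A) =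
      Module.finrank ℤ (ι → ℤ) := Submodule.finrank_quotient_add_finrank (LinearMap.range A)
  have h0 : Module.finrank ℤ ((ι → ℤ) ⧸ LinearMap.range A) = Module.finrank ℤ (ι → ℤ) :=
    e.finrank_eq
  have h2 : Module.finrank ℤ (LinearMap.range A) = 0 := by omega
  have h3 : Subsingleton (LinearMap.range A) := Module.finrank_zero_iff.mp h2
  rw [← LinearMap.range_eq_bot, Submodule.eq_bot_iff]
  intro x hx
  exact congrArg Subtype.val (Subsingleton.elim (⟨x, hx⟩ : LinearMap.range A) 0)

/-- **Third clause, algebraic form**: if the cokernel of `wordProduct (stdSymp ℤ g) l − 1` on `ℤ^{2g}`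
is free of rank `2g` then the signed homological monodromy is trivial. [folklore] -/
theorem wordProduct_eq_one_of_nonempty_coker_equiv (g : ℕ) (l : List ((Fin g ⊕ Fin g → ℤ) × Bool))
    (h : Nonempty (((Fin g ⊕ Fin g → ℤ) ⧸ LinearMap.range (wordProduct (stdSymp ℤ g) l - 1)) ≃ₗ[ℤ]
      (Fin g ⊕ Fin g → ℤ))) :
    wordProduct (stdSymp ℤ g) l = 1 :=
  sub_eq_zero.mp (eq_zero_of_nonempty_quotient_range_equiv _ h)

/-- **Second clause, algebraic form**: if `ℤ^{2g}/⟨classes of l⟩` is a torsion group (on paper: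
it is `H₁(X(F; l); ℤ)`, Gompf–Stipsicz §8.2, and `H₁(X; ℚ) = 0`) then the classes of `l`, read over `ℚ`,
span `ℚ^{2g}`: a multiple `N • e_k`, `N ≠ 0`, of every basis vector lies in the `ℤ`-span of the
classes, so `e_k` lies in their `ℚ`-span. [folklore] -/
theorem span_letters_ratWord_eq_top_of_isTorsion {g : ℕ} (l : List ((Fin g ⊕ Fin g → ℤ) × Bool))
    (h : Module.IsTorsion ℤ ((Fin g ⊕ Fin g → ℤ) ⧸ Submodule.span ℤ (letters l))) :
    Submodule.span ℚ (letters (ratWord l)) = ⊤ := by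
  -- the coordinatewise cast `ℤ^{2g} → ℚ^{2g}` as a `ℤ`-linear map
  let c : (Fin g ⊕ Fin g → ℤ) →ₗ[ℤ] (Fin g ⊕ Fin g → ℚ) :=
    ((Int.castRingHom ℚ).compLeft (Fin g ⊕ Fin g)).toAddMonoidHom.toIntLinearMap
  have hc : ∀ v : Fin g ⊕ Fin g → ℤ, c v = fun i => (v i : ℚ) := fun v => rfl
  have hletters : letters (ratWord l) = c '' letters l := by
    rw [ratWord, letters_mapWord]
    exact congrArg (fun φ : (Fin g ⊕ Fin g → ℤ) → (Fin g ⊕ Fin g → ℚ) => φ '' letters l)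
      (funext fun v => (hc v).symm)
  -- every basis vector of `ℚ^{2g}` lies in the span
  have hsingle : ∀ k, Pi.single k (1 : ℚ) ∈ Submodule.span ℚ (letters (ratWord l)) := by
    intro k
    obtain ⟨⟨N, hN⟩, hNk⟩ := @h (Submodule.Quotient.mk (Pi.single k (1 : ℤ)))
    have hmem : (N : ℤ) • Pi.single k (1 : ℤ) ∈ Submodule.span ℤ (letters l) := by
      rw [← Submodule.Quotient.mk_eq_zero, Submodule.Quotient.mk_smul]
      exact hNk
    have hN0 : (N : ℚ) ≠ 0 := by exact_mod_cast nonZeroDivisors.ne_zero hN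
    have h1 : c ((N : ℤ) • Pi.single k (1 : ℤ)) ∈ Submodule.span ℤ (c '' letters l) := by
      rw [← Submodule.map_span]
      exact Submodule.mem_map_of_mem hmem
    have h2 : c ((N : ℤ) • Pi.single k (1 : ℤ)) ∈ Submodule.span ℚ (letters (ratWord l)) := by
      rw [hletters]
      exact Submodule.span_le_restrictScalars ℤ ℚ _ h1
    have h3 : c ((N : ℤ) • Pi.single k (1 : ℤ)) = (N : ℚ) • Pi.single k (1 : ℚ) := by
      rw [map_zsmul, hc]
      ext i
      by_cases hi : i = k
      · subst hi; simp
      · simp [hi]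
    rw [h3] at h2
    have h4 := Submodule.smul_mem _ (N : ℚ)⁻¹ h2
    rwa [smul_smul, inv_mul_cancel₀ hN0, one_smul] at h4
  rw [eq_top_iff, ← (Pi.basisFun ℚ (Fin g ⊕ Fin g)).span_eq, Submodule.span_le]
  rintro _ ⟨k, rfl⟩
  rw [Pi.basisFun_apply]
  exact hsingle k

/-- **Second clause from `H₁(X; ℤ) = 0`**: if `ℤ^{2g}/⟨classes of l⟩` is trivial (on paper
`= H₁(X; ℤ) = H₁(M; ℤ) = 0` for a model of a homotopy sphere) the classes span `ℚ^{2g}`. [folklore] -/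
theorem span_letters_ratWord_eq_top_of_subsingleton {g : ℕ} (l : List ((Fin g ⊕ Fin g → ℤ) × Bool))
    (h : Subsingleton ((Fin g ⊕ Fin g → ℤ) ⧸ Submodule.span ℤ (letters l))) :
    Submodule.span ℚ (letters (ratWord l)) = ⊤ :=
  span_letters_ratWord_eq_top_of_isTorsion l fun _ => ⟨1, Subsingleton.elim _ _⟩

/-- Torsion transports along linear equivalences (used to move `H₁(X; ℤ)` onto `ℤ^{2g}/⟨classes⟩`).
[folklore] -/
theorem isTorsion_of_linearEquiv {R : Type*} [CommRing R] {P Q : Type*} [AddCommGroup P] [Module R P]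
    [AddCommGroup Q] [Module R Q] (e : P ≃ₗ[R] Q) (h : Module.IsTorsion R P) : Module.IsTorsion R Q := by
  intro y
  obtain ⟨a, ha⟩ := @h (e.symm y)
  refine ⟨a, ?_⟩
  rw [Submonoid.smul_def] at ha ⊢
  have := congrArg e ha
  rwa [map_zero, map_smul, LinearEquiv.apply_symm_apply] at this


/-- **The degenerate instance `g = 0` of the stub.**  Over `ℤ⁰ = 0` the span and monodromy clauses are
automatic (every submodule of the zero module is `⊤`, every endomorphism is `1`), so at genus `0` the
registered statement says exactly that a one-sided model `S⁴ ≃ₕ M = X ∪ Base 0` (`Base 0 ≅ B⁴`) has NO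
2-handles — the Euler-characteristic count `χ(M) = 2 = (1 + n) + 1`.  Recorded as the audit of the
degenerate case (no counter-instance arises there). [folklore] -/
theorem counts_genus_zero_iff (l : List ((Fin 0 ⊕ Fin 0 → ℤ) × Bool)) :
    (l.length = 4 * 0 ∧ Submodule.span ℚ (letters (ratWord l)) = ⊤ ∧ wordProduct (stdSymp ℤ 0) l = 1) ↔
      l = [] := by
  haveI : Subsingleton (Fin 0 ⊕ Fin 0 → ℚ) := ⟨fun a b => funext fun i => by rcases i with ⟨⟨_, h⟩⟩ | ⟨⟨_, h⟩⟩ <;> omega⟩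
  haveI : Subsingleton (Fin 0 ⊕ Fin 0 → ℤ) := ⟨fun a b => funext fun i => by rcases i with ⟨⟨_, h⟩⟩ | ⟨⟨_, h⟩⟩ <;> omega⟩
  have h2 : Submodule.span ℚ (letters (ratWord l)) = ⊤ :=
    Subsingleton.elim (α := Submodule ℚ (Fin 0 ⊕ Fin 0 → ℚ)) _ _
  have h3 : wordProduct (stdSymp ℤ 0) l = 1 := LinearMap.ext fun x => Subsingleton.elim _ _
  simp only [h2, h3, and_true, Nat.mul_zero, List.length_eq_zero_iff]

end Algebra

/-! ## The seam of the base is nonempty -/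

section BaseFacts

/-- **`∂ Base g ≠ ∅`**: the point `(x, y) = (0, √(3/2))` of `ℂ²` has `w = y² − x^{2g+1} − 1 = 1/2` and
`eta ‖x‖² = 0`, so `rho = 1/4`: it lies on the boundary `{rho = 1/4}` of the base. [folklore] -/
theorem nonempty_bBase_carrier (g : ℕ) : Nonempty (bBase g).carrier := by
  set y₀ : ℝ := Real.sqrt (3 / 2) with hy₀
  have hy2 : ((y₀ : ℂ)) ^ 2 = (3 / 2 : ℂ) := by
    rw [← Complex.ofReal_pow, hy₀, Real.sq_sqrt (by norm_num)]
    push_cast; ring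
  have hw : w g (mk 0 y₀) = 1 / 2 := by
    simp only [w, Phi, cx_mk, cy_mk, hy2, zero_pow (Nat.succ_ne_zero _)]
    norm_num
  have hrho : rho g (mk 0 y₀) = 1 / 4 := by
    rw [rho, hw, cx_mk, norm_zero, eta_of_le (by norm_num)]
    norm_num
  let p : Base g := RegularSublevel.mk (isRegularLevel_rho g) (mk 0 y₀) (by rw [hrho])
  have hp : p ∈ (𝓡∂ 4).boundary (Base g) :=
    (RegularSublevel.mem_boundary_iff (isRegularLevel_rho g) p).2 hrho
  exact ⟨⟨p, hp⟩⟩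

/-- The base is a nonempty compact 4-manifold with nonempty boundary; in particular any manifold glued
to it along a diffeomorphism of boundaries has nonempty boundary too. [folklore] -/
theorem nonempty_carrier_of_diffeomorph_bBase {g : ℕ} {X : Type} [TopologicalSpace X]
    [ChartedSpace (EuclideanHalfSpace 4) X] (bX : BoundaryData (𝓡∂ 4) X (𝓡 3))
    (Ψ : bX.carrier ≃ₘ⟮𝓡 3, 𝓡 3⟯ (bBase g).carrier) : Nonempty bX.carrier :=
  (nonempty_bBase_carrier g).map Ψ.symm

end BaseFacts

/-! ## Bookkeeping of a one-sided gluing `M = X ∪_Ψ Base g` of a homotopy 4-sphere -/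

section Gluing

variable {M : Type} [TopologicalSpace M] [T2Space M] [SecondCountableTopology M]
  [ChartedSpace (EuclideanSpace ℝ (Fin 4)) M] [IsManifold (𝓡 4) ∞ M]
  {X : Type} [TopologicalSpace X] [T2Space X] [SecondCountableTopology X] [CompactSpace X]
  [ChartedSpace (EuclideanHalfSpace 4) X] [IsManifold (𝓡∂ 4) ∞ X] {g : ℕ}

omit [SecondCountableTopology X] [IsManifold (𝓡∂ 4) ∞ X] in
/-- **`H₁(X; ℚ) = 0 ⇒ H₁(X; ℤ)` is torsion** for a compact (topological) 4-manifold with boundary: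
`Hₖ(X; ℤ)` is finitely generated (tree `finite_singularHomology_of_compact_chartedSpace_halfSpace`, Wilder)
and `rank_ℤ Hₖ(X; ℤ) = dim_ℚ Hₖ(X; ℚ)` (tree `bettiNumber_int_eq_rat`, Hatcher Cor. 3A.6 (a)), so a vanishing
rational group leaves a finitely generated group of rank `0`. [folklore] -/
theorem isTorsion_homology_int_of_isZero_rat (k : ℕ) (h : IsZero (singularHomology ℚ ℚ X k)) :
    Module.IsTorsion ℤ (singularHomology ℤ ℤ X k) := by
  haveI : Module.Finite ℤ (singularHomology ℤ ℤ X k) :=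
    finite_singularHomology_of_compact_chartedSpace_halfSpace ℤ ℤ (n := 3) k
  haveI : Subsingleton (singularHomology ℚ ℚ X k) := ModuleCat.subsingleton_of_isZero h
  have h0 : bettiNumber ℚ X k = 0 := Module.finrank_zero_of_subsingleton
  have h1 : Module.finrank ℤ (singularHomology ℤ ℤ X k) = 0 := by
    rw [← h0, ← bettiNumber_int_eq_rat X k]; rfl
  exact Module.finrank_eq_zero_iff_isTorsion.mp h1

/-- **`H₁(X; ℚ) = 0` for the handlebody side of a one-sided model of a homotopy 4-sphere, given
`H₂(Base g; ℚ) = 0`.**  In the exact `H₂(M, jX X) → H₁(jX X) → H₁(M) = 0` the left group is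
`H₂(Base g, ∂ Base g; ℚ) ≅ H²(Base g; ℚ) ↪ H₂(Base g; ℚ)^* = 0` (excision for the gluing; Lefschetz duality
for the orientation of `Base g` pulled back from the orientable `M`; field UCT).  On paper the hypothesis
holds because `Base g ≅ F_{g,1} × D² ≃ ⋁^{2g} S¹` (Milnor 1968, Thm. 9.1); it is kept explicit here.  This
is the topological half of the second clause of `modelsOn_counts_of_homotopyEquiv_sphere`
(Gompf–Stipsicz 1999, §8.2: "`H₁(X; ℤ) = H₁(M; ℤ) = 0`, the cap adds only 3- and 4-handles"). [folklore] -/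
theorem isZero_homology_one_of_gluing_base (e : M ≃ₕ Metric.sphere (0 : EuclideanSpace ℝ (Fin 5)) 1)
    (bX : BoundaryData (𝓡∂ 4) X (𝓡 3)) (Ψ : bX.carrier ≃ₘ⟮𝓡 3, 𝓡 3⟯ (bBase g).carrier)
    (hglue : IsBoundaryGluing bX (bBase g) Ψ (𝓡 4) M)
    (hB2 : IsZero (singularHomology ℚ ℚ (Base g) 2)) : IsZero (singularHomology ℚ ℚ X 1) := by
  haveI : Nonempty (bBase g).carrier := nonempty_bBase_carrier g
  obtain ⟨jA, jB, hjA, hjB, hcover, hR⟩ := hglue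
  -- orientation of `Base g`, pulled back from `M`; `H₂(Base g, ∂; ℚ) = 0`; `H₂(M, jA X; ℚ) = 0`
  have hoM : IsOrientable (𝓡 4) M := isOrientable_of_homotopyEquiv_sphere_four_holds M e
  have hoB : IsOrientable (𝓡∂ 4) (Base g) := IsOrientable.of_isSmoothEmbedding hjB hoM
  have hrelB : IsZero (relativeSingularHomology ℚ ℚ (Base g) ((𝓡∂ 4).boundary (Base g)) 2) :=
    isZero_relHomology_of_isOrientable (bBase g) hoB (p := 2) (q := 2) rfl hB2
  have hrelM : IsZero (relativeSingularHomology ℚ ℚ M (range jA) 2) :=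
    isZero_relHomology_range_of_isZero bX (bBase g) Ψ hjA hjB hcover hR hrelB
  -- `H₁(M; ℚ) = 0`, and exactness at `H₁(jA X)`
  have hM1 : IsZero (singularHomology ℚ ℚ M 1) :=
    Witness.isZero_homology_of_homotopyEquiv_sphere e one_ne_zero (by norm_num)
  have hS : IsZero (singularHomology ℚ ℚ ↥(range jA) 1) :=
    (relativeSingularHomology.exact_δ_map ℚ ℚ (range jA) 1).isZero_of_both_zeros
      (hrelM.eq_of_src _ _) (hM1.eq_of_tgt _ _)
  exact hS.of_iso (singularHomology.mapIso ℚ ℚ hjA.isEmbedding.toHomeomorph 1)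

/-- **`X` is connected for a one-sided model of a homotopy 4-sphere, given `H₃(Base g; ℚ) = 0`**:
`H₁(M, jX X; ℚ) ≅ H₁(Base g, ∂; ℚ) ≅ H³(Base g; ℚ) ↪ H₃(Base g; ℚ)^* = 0`, so `H₀(X) → H₀(M) ≅ ℚ` is
injective and `H₀` detects components.  (On paper `H₃(F_{g,1} × D²) = 0`.) [folklore] -/
theorem connectedSpace_of_gluing_base (e : M ≃ₕ Metric.sphere (0 : EuclideanSpace ℝ (Fin 5)) 1)
    (bX : BoundaryData (𝓡∂ 4) X (𝓡 3)) (Ψ : bX.carrier ≃ₘ⟮𝓡 3, 𝓡 3⟯ (bBase g).carrier)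
    (hglue : IsBoundaryGluing bX (bBase g) Ψ (𝓡 4) M)
    (hB3 : IsZero (singularHomology ℚ ℚ (Base g) 3)) : ConnectedSpace X := by
  haveI : Nonempty (bBase g).carrier := nonempty_bBase_carrier g
  haveI : Nonempty bX.carrier := nonempty_carrier_of_diffeomorph_bBase bX Ψ
  haveI : Nonempty X := ‹Nonempty bX.carrier›.map bX.incl
  obtain ⟨jA, jB, hjA, hjB, hcover, hR⟩ := hglue
  haveI := connectedSpace_of_homotopyEquiv_sphere e
  haveI : LocallyPathConnectedSpace M :=
    ChartedSpace.locallyPathConnectedSpace (EuclideanSpace ℝ (Fin 4)) M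
  haveI : PathConnectedSpace M := pathConnectedSpace_iff_connectedSpace.mpr ‹_›
  haveI : LocallyPathConnectedSpace X := ChartedSpace.locallyPathConnectedSpace (EuclideanHalfSpace 4) X
  have hoM : IsOrientable (𝓡 4) M := isOrientable_of_homotopyEquiv_sphere_four_holds M e
  have hrelB : IsZero (relativeSingularHomology ℚ ℚ (Base g) ((𝓡∂ 4).boundary (Base g)) 1) :=
    isZero_relHomology_of_isOrientable (bBase g) (IsOrientable.of_isSmoothEmbedding hjB hoM)
      (p := 3) (q := 1) rfl hB3
  have hMA : IsZero (relativeSingularHomology ℚ ℚ M (range jA) 1) :=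
    isZero_relHomology_range_of_isZero bX (bBase g) Ψ hjA hjB hcover hR hrelB
  haveI hpA : PreconnectedSpace X := preconnectedSpace_of_isZero_relHomology hjA.isEmbedding hMA
  exact ⟨‹Nonempty X›⟩

omit [T2Space X] [SecondCountableTopology X] [CompactSpace X] [IsManifold (𝓡∂ 4) ∞ X] in
/-- **Third clause from the seam.**  If `H₁(∂X; ℤ)` is the cokernel of `μ_* − 1`,
`μ_* = wordProduct (stdSymp ℤ g) l` (on paper: Kas 1980 / Etnyre–Fuller 2006, §2, `∂X ∖ B` is the
`F`-bundle with monodromy `∏ t_{γᵢ}^{±1}`, acting on `H₁(F)` by the signed Picard–Lefschetz transvections),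
and `H₁(∂ Base g; ℤ) ≅ ℤ^{2g}` (on paper: `∂(F_{g,1} × D²) ≅ #^{2g} S¹ × S²`), then ANY diffeomorphism
`Ψ : ∂X ≅ ∂ Base g` forces `μ_* = 1` (Gompf–Stipsicz 1999, §8.2). [folklore] -/
theorem wordProduct_eq_one_of_seam {l : List ((Fin g ⊕ Fin g → ℤ) × Bool)}
    (bX : BoundaryData (𝓡∂ 4) X (𝓡 3)) (Ψ : bX.carrier ≃ₘ⟮𝓡 3, 𝓡 3⟯ (bBase g).carrier)
    (hX : Nonempty (singularHomology ℤ ℤ bX.carrier 1 ≃ₗ[ℤ]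
      ((Fin g ⊕ Fin g → ℤ) ⧸ LinearMap.range (wordProduct (stdSymp ℤ g) l - 1))))
    (hB : Nonempty (singularHomology ℤ ℤ (bBase g).carrier 1 ≃ₗ[ℤ] (Fin g ⊕ Fin g → ℤ))) :
    wordProduct (stdSymp ℤ g) l = 1 := by
  obtain ⟨eX⟩ := hX
  obtain ⟨eB⟩ := hB
  -- `Ψ` is a homeomorphism `∂X ≅ ∂ Base g`, hence an isomorphism on `H₁(−; ℤ)`
  let eΨ : singularHomology ℤ ℤ bX.carrier 1 ≃ₗ[ℤ] singularHomology ℤ ℤ (bBase g).carrier 1 :=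
    (singularHomology.mapIso ℤ ℤ Ψ.toHomeomorph 1).toLinearEquiv
  exact wordProduct_eq_one_of_nonempty_coker_equiv g l ⟨eX.symm.trans (eΨ.trans eB)⟩

/-- **Second clause from the gluing.**  For a boundary gluing `M = X ∪_Ψ Base g` of a homotopy 4-sphere
with `H₂(Base g; ℚ) = 0`, if `H₁(X; ℤ) ≅ ℤ^{2g}/⟨classes of l⟩` (on paper: Gompf–Stipsicz §8.2 for the
Lefschetz handlebody `X = X(F; l)`; kept as the explicit hypothesis `hX1`) then the classes of `l` span
`ℚ^{2g}`: `H₁(X; ℚ) = 0` (`isZero_homology_one_of_gluing_base`) makes the finitely generated `H₁(X; ℤ)`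
torsion (`isTorsion_homology_int_of_isZero_rat`). [folklore] -/
theorem span_letters_ratWord_eq_top_of_gluing_base {l : List ((Fin g ⊕ Fin g → ℤ) × Bool)}
    (e : M ≃ₕ Metric.sphere (0 : EuclideanSpace ℝ (Fin 5)) 1)
    (bX : BoundaryData (𝓡∂ 4) X (𝓡 3)) (Ψ : bX.carrier ≃ₘ⟮𝓡 3, 𝓡 3⟯ (bBase g).carrier)
    (hglue : IsBoundaryGluing bX (bBase g) Ψ (𝓡 4) M)
    (hB2 : IsZero (singularHomology ℚ ℚ (Base g) 2))
    (hX1 : Nonempty (singularHomology ℤ ℤ X 1 ≃ₗ[ℤ] ((Fin g ⊕ Fin g → ℤ) ⧸ Submodule.span ℤ (letters l)))) :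
    Submodule.span ℚ (letters (ratWord l)) = ⊤ := by
  obtain ⟨e1⟩ := hX1
  exact span_letters_ratWord_eq_top_of_isTorsion l (isTorsion_of_linearEquiv e1
    (isTorsion_homology_int_of_isZero_rat 1 (isZero_homology_one_of_gluing_base e bX Ψ hglue hB2)))

end Gluing

/-! ## Read on `ModelsOn` -/

section Models

variable {M : Type} [TopologicalSpace M] [T2Space M] [SecondCountableTopology M]
  [ChartedSpace (EuclideanSpace ℝ (Fin 4)) M] [IsManifold (𝓡 4) ∞ M]

/-- **A one-sided model of a homotopy 4-sphere has a connected handlebody side with `H₁ = 0` over `ℚ`,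
given `H₂(Base g; ℚ) = H₃(Base g; ℚ) = 0`**: the `ModelsOn` form of the two gluing lemmas, exhibiting the
Lefschetz handlebody `X(F_{g,1}; l)` of the model together with its bookkeeping. [folklore] -/
theorem exists_isLefschetzHandlebody_of_modelsOn {g : ℕ} {l : List ((Fin g ⊕ Fin g → ℤ) × Bool)}
    (e : M ≃ₕ Metric.sphere (0 : EuclideanSpace ℝ (Fin 5)) 1) (hM : ModelsOn M g l)
    (hB2 : IsZero (singularHomology ℚ ℚ (Base g) 2)) (hB3 : IsZero (singularHomology ℚ ℚ (Base g) 3)) :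
    ∃ (X : Type) (_ : TopologicalSpace X) (_ : T2Space X) (_ : SecondCountableTopology X)
      (_ : CompactSpace X) (_ : ChartedSpace (EuclideanHalfSpace 4) X) (_ : IsManifold (𝓡∂ 4) ∞ X),
      IsLefschetzHandlebody g l X ∧ ConnectedSpace X ∧ IsZero (singularHomology ℚ ℚ X 1) := by
  obtain ⟨X, _, _, _, _, _, _, bX, Ψ, hX, hglue⟩ := hM
  exact ⟨X, inferInstance, inferInstance, inferInstance, inferInstance, inferInstance, inferInstance, hX,
    connectedSpace_of_gluing_base e bX Ψ hglue hB3, isZero_homology_one_of_gluing_base e bX Ψ hglue hB2⟩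

end Models


/-! ## The registered sub-goal of the stub: the bookkeeping of a one-sided gluing, assembled -/

section SubGoal

/-- **Sub-goal `stub_modelsOn_counts_gluingBookkeeping` of stub `stub_modelsOn_counts`** (line
`modp-braid-orbits`, r9).  For a homotopy 4-sphere `M ≃ₕ S⁴` presented as ANY boundary gluing
`M = X ∪_Ψ Base g` of a compact 4-manifold `X` and the concrete Lefschetz base (the unfolded gluing clause
of `ModelsOn M g l`), and given `H₂(Base g; ℚ) = 0` (topology of the base, Milnor 1968 Thm. 9.1 — the one
input about `Base g`): `H₁(X; ℚ) = 0`, `H₁(X; ℤ)` is torsion, the second clause of the stub follows from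
`H₁(X; ℤ) ≅ ℤ^{2g}/⟨classes⟩` (Gompf–Stipsicz §8.2 for `X = X(F; l)`), and the third clause follows from
`H₁(∂X; ℤ) ≅ coker(μ_* − 1)` (Kas 1980) and `H₁(∂ Base g; ℤ) ≅ ℤ^{2g}`.  Everything else of
Gompf–Stipsicz's bookkeeping (excision, Lefschetz duality, UCT, rank–nullity) is proved above. [folklore] -/
theorem stub_modelsOn_counts_gluingBookkeeping :
    ∀ (M : Type) [TopologicalSpace M] [T2Space M] [SecondCountableTopology M]
      [ChartedSpace (EuclideanSpace ℝ (Fin 4)) M] [IsManifold (𝓡 4) ∞ M] (g : ℕ)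
      (l : List ((Fin g ⊕ Fin g → ℤ) × Bool)),
      M ≃ₕ Metric.sphere (0 : EuclideanSpace ℝ (Fin 5)) 1 →
      ∀ (X : Type) [TopologicalSpace X] [T2Space X] [SecondCountableTopology X] [CompactSpace X]
        [ChartedSpace (EuclideanHalfSpace 4) X] [IsManifold (𝓡∂ 4) ∞ X]
        (bX : BoundaryData (𝓡∂ 4) X (𝓡 3)) (Ψ : bX.carrier ≃ₘ⟮𝓡 3, 𝓡 3⟯ (bBase g).carrier),
        IsBoundaryGluing bX (bBase g) Ψ (𝓡 4) M →
        CategoryTheory.Limits.IsZero (singularHomology ℚ ℚ (Base g) 2) →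
        CategoryTheory.Limits.IsZero (singularHomology ℚ ℚ X 1) ∧
        Module.IsTorsion ℤ (singularHomology ℤ ℤ X 1) ∧
        (Nonempty ((singularHomology ℤ ℤ X 1) ≃ₗ[ℤ] ((Fin g ⊕ Fin g → ℤ) ⧸ Submodule.span ℤ (letters l))) →
          Submodule.span ℚ (letters (ratWord l)) = ⊤) ∧
        (Nonempty ((singularHomology ℤ ℤ bX.carrier 1) ≃ₗ[ℤ]
            ((Fin g ⊕ Fin g → ℤ) ⧸ LinearMap.range (wordProduct (stdSymp ℤ g) l - 1))) →
          Nonempty ((singularHomology ℤ ℤ (bBase g).carrier 1) ≃ₗ[ℤ] (Fin g ⊕ Fin g → ℤ)) →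
          wordProduct (stdSymp ℤ g) l = 1) := by
  intro M _ _ _ _ _ g l e X _ _ _ _ _ _ bX Ψ hglue hB2
  have h1 : IsZero (singularHomology ℚ ℚ X 1) := isZero_homology_one_of_gluing_base e bX Ψ hglue hB2
  exact ⟨h1, isTorsion_homology_int_of_isZero_rat 1 h1,
    fun hX1 => span_letters_ratWord_eq_top_of_gluing_base e bX Ψ hglue hB2 hX1,
    fun hX hB => wordProduct_eq_one_of_seam bX Ψ hX hB⟩

end SubGoal

end Summit.SmoothPoincare4.SmoothPoincare4.Theorems.AcyclicBisectionExists.ModpBraidOrbits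

end
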